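import Summits.QuantumFields.BalabanUV.T4Continuum.Spine.NE9.TowerCarriers
import Summits.QuantumFields.BalabanUV.T4Continuum.Spine.NE9.TowerRateRelocation

/-!
# T⁴ programme, spine estimate NE9 — NON-VACUITY of the tower-of-carriers binders: `TowerNE5` ∧ `TowerNE9` (with moduli of geometric
# age-growth) are JOINTLY inhabited by a NON-CONSTANT tower, and the END `summable_delta_of_tower_growing` fires on it — census rider to
# rows C27∕C28 of cell `pub-balaban-gaps`, seat ne9 (gen 4)

Cell `pub-balaban-gaps` (YM blitz G2, seat ne9, unit `pub-balaban-gaps-ne9-g4`; record `run/shared/lean/pub/pub-balaban-gaps/ne/NE9.md` §5 rows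
C27∕C28).  Refuters hunt vacuity: a junction whose binders cannot be jointly satisfied non-trivially proves nothing.  Row C27
(`TowerCarriers`) typed `TowerNE5`∕`TowerNE9` := `T4OutputRate.NE5`∕`.NE9` BY NAME at every pair of consecutive run lengths and derived node
U3's bracket majorant and node U6's `Summable δ`; row C28 (`TowerRateRelocation`) supplied the linear Markov tower `linTower a φ`.  Here the
two meet: on the ONE-DOMAIN tower data `toyTower` (one physical domain present from run `0`, trivial backgrounds and transports) the
functionals `E k g U X := linTower a φ k g` with a CONTRACTING channel `0 ≤ a < 1` and a bounded Lipschitz creation function `φ` satisfy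
`TowerNE5` (rate `θ = a`, `towerNE5_toy`) AND `TowerNE9` with the bounded moduli `ℓ·|a|^{m−1−i} ≤ ℓ` (`towerNE9_toy`, `moduli_toy_bound`), the
tower is non-constant as soon as `φ` is (`toyE_nonconstant`), and `TowerCarriers.summable_delta_of_tower_growing` yields a cutoff-independent
injection dominating every coupling bracket with `Summable (T4CauchySum.delta E₀ ρ inj)` (`summable_delta_toy`).  So the binders of rows
C24–C27 are jointly satisfiable with every inequality non-trivial; by row C28 the SAME data with `a ≥ 1` violates `TowerNE5` — the witness
sits exactly on the contracting side of the dichotomy.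

HONEST FRAMING: a toy inhabitant of hypothesis SHAPES (real analysis); nothing of Bałaban's step is modelled or asserted; tower-NE5 and NE9
NOT PRINTED ∕ NOT PROVED for Bałaban's functionals; spine PROVED 0∕9 unchanged; NOT UV stability, NOT the continuum limit, NOT infinite
volume, NOT a mass gap, NOT Clay.

References (TYPES only): [Balaban1987RG1] = T. Bałaban, Commun. Math. Phys. **109** (1987) 249–301, Thm 1 p. 259 (window).
-/

namespace Summit.QuantumFields.BalabanUV.T4Continuum.NE9.TowerCarriersWitness

open scoped BigOperators
open Finset
open Literature.MathematicalPhysics.QuantumFieldTheory.Balaban1983to89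
open Literature.MathematicalPhysics.QuantumFieldTheory.Balaban1983to89.T4OutputRate
open T4CauchySum (delta)
open Summit.QuantumFields.BalabanUV.T4Continuum.NE9.TowerCarriers
open Summit.QuantumFields.BalabanUV.T4Continuum.NE9.TowerRateRelocation

/-- The ONE-DOMAIN TOWER DATA: a single physical localization domain present from run `0` (`r = 0`, tree length `0`), one background, identity
transports, zero gauge. [folklore] -/
def toyTower : TowerData where
  Dom := Unit
  r := fun _ => 0
  d := fun _ => 0
  d_nonneg := fun _ => le_rfl
  B := Unit
  gauge := fun _ _ => 0
  gauge_nonneg := fun _ _ => le_rfl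
  tr := fun _ U => U

/-- The toy functionals on `toyTower`: run `k`'s term is the linear Markov tower `linTower a φ k g` of row C28. [folklore] -/
noncomputable def toyE (a : ℝ) (φ : ℝ → ℝ) : ℕ → (ℕ → ℝ) → toyTower.B → toyTower.Dom → ℝ :=
  fun k g _ _ => linTower a φ k g

variable {a : ℝ} {φ : ℝ → ℝ}

/-- **`TowerNE5` HOLDS on the toy** for a contracting channel: `0 ≤ a < 1`... indeed for any `0 ≤ a`, with rate `θ = a` and `C₅ = C` where
`|φ| ≤ C` on `]0, γ]` (the tower difference is `a^k·φ(b)` by `towerDiff_eq`). [folklore] -/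
theorem towerNE5_toy {γ κ C : ℝ} (ha0 : 0 ≤ a) (hφ : ∀ x, 0 < x → x ≤ γ → |φ x| ≤ C) :
    TowerNE5 toyTower (toyE a φ) γ κ a C := by
  intro k b hb0 hbγ g _ U X
  show |linTower a φ k g - linTower a φ (k + 1) (prepend b g)| ≤ C * a ^ (k - 0) * Real.exp (-(κ * 0))
  have h := towerDiff_eq (a := a) (φ := φ) k (prepend b g)
  have e : (fun i => prepend b g (i + 1)) = g := funext fun i => rfl
  rw [e, prepend_zero] at h
  rw [abs_sub_comm, h, Nat.sub_zero, mul_zero, neg_zero, Real.exp_zero, mul_one, abs_mul,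
    abs_of_nonneg (pow_nonneg ha0 k), mul_comm]
  exact mul_le_mul_of_nonneg_right (hφ b hb0 hbγ) (pow_nonneg ha0 k)

/-- **`TowerNE9` HOLDS on the toy** with the natural moduli `Λ m i = ℓ·|a|^{m−1−i}` of `moduli_linTower` (`φ` `ℓ`-Lipschitz). [folklore] -/
theorem towerNE9_toy {γ κ ℓ : ℝ} (hφ : ∀ x y, |φ x - φ y| ≤ ℓ * |x - y|) :
    TowerNE9 toyTower (toyE a φ) γ κ (fun m i => ℓ * |a| ^ (m - 1 - i)) := by
  intro k g _ g' _ U X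
  show |linTower a φ k g - linTower a φ k g'| ≤
    Real.exp (-(κ * 0)) * ∑ i ∈ range (k - 0), ℓ * |a| ^ (k - 0 - 1 - i) * |g i - g' i|
  rw [mul_zero, neg_zero, Real.exp_zero, one_mul, Nat.sub_zero]
  exact moduli_linTower hφ k g g'

/-- The natural moduli are BOUNDED by `ℓ` when `|a| ≤ 1` (so they fit `summable_delta_of_tower_growing` with `C₉ = ℓ`, `μ = 1`). [folklore] -/
theorem moduli_toy_bound {ℓ : ℝ} (hℓ : 0 ≤ ℓ) (ha : |a| ≤ 1) (m i : ℕ) (_him : i < m) :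
    0 ≤ ℓ * |a| ^ (m - 1 - i) ∧ ℓ * |a| ^ (m - 1 - i) ≤ ℓ * (1 : ℝ) ^ (m - i) := by
  refine ⟨by positivity, ?_⟩
  rw [one_pow]
  exact mul_le_mul_of_nonneg_left (pow_le_one₀ (abs_nonneg a) ha) hℓ

/-- The toy tower is NON-CONSTANT as soon as `φ` separates two admissible couplings: at run `1`, `E 1 g = φ(g_0)`. [folklore] -/
theorem toyE_nonconstant {b b' : ℝ} (h : φ b ≠ φ b') (U : toyTower.B) (X : toyTower.Dom) :
    toyE a φ 1 (fun _ => b) U X ≠ toyE a φ 1 (fun _ => b') U X := by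
  show linTower a φ 1 (fun _ => b) ≠ linTower a φ 1 (fun _ => b')
  rw [show (1 : ℕ) = 0 + 1 from rfl, linTower_succ, linTower_succ, linTower_zero, linTower_zero]
  simpa using h

/-- **THE END FIRES ON THE TOY (non-vacuity of rows C24–C27).**  `0 ≤ a < 1`, `φ` bounded by `C ≥ 0` on `]0, γ]` and `ℓ`-Lipschitz
(`ℓ ≥ 0`), `0 ≤ κ`, node U2's geometric profile `D·θ′^i` (`D ≥ 0`, `0 ≤ θ′ < 1`): `TowerCarriers.summable_delta_of_tower_growing` applies to
`toyTower`, `toyE a φ` with `θ = a`, `C₉ = ℓ`, `μ = 1`, `N = 2` — a cutoff-independent injection dominating every coupling bracket of the toy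
at every run, with `Summable (T4CauchySum.delta E₀ ρ inj)`. [folklore] -/
theorem summable_delta_toy {γ κ C ℓ D θ' : ℝ} (ha0 : 0 ≤ a) (ha1 : a < 1) (hC : 0 ≤ C)
    (hφ : ∀ x, 0 < x → x ≤ γ → |φ x| ≤ C) (hφl : ∀ x y, |φ x - φ y| ≤ ℓ * |x - y|) (hℓ : 0 ≤ ℓ)
    (hκ : 0 ≤ κ) (hD : 0 ≤ D) (hθ'0 : 0 ≤ θ') (hθ'1 : θ' < 1) {E₀ ρ : ℝ} (hE : 0 ≤ E₀) (hρ : 0 ≤ ρ) (hρ1 : ρ < 1) :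
    let inj : ℕ → ℕ → ℝ := fun _ j =>
      2 * C * a ^ (j / 2) / (1 - a) + ℓ * D * (j / 2 : ℕ) * (1 * θ' ^ (2 - 1)) ^ (j / 2)
    (∀ (K k : ℕ) (U : toyTower.B) (X : toyTower.Dom), toyTower.r X ≤ k → ∀ g ∈ Window γ, ∀ g' ∈ Window γ,
        (∀ i, |g i - g' i| ≤ D * θ' ^ i) → |toyE a φ k g U X - toyE a φ k g' U X| ≤ inj K (k - toyTower.r X)) ∧
      Summable (delta E₀ ρ inj) :=
  summable_delta_of_tower_growing toyTower hC ha0 ha1 le_rfl hD hθ'0 hθ'1.le hκ (towerNE5_toy ha0 hφ) (towerNE9_toy hφl) hℓ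
    (fun m i him => moduli_toy_bound hℓ (by rw [abs_of_nonneg ha0]; exact ha1.le) m i him) (N := 2) (by norm_num)
    (by rw [one_mul, show (2 : ℕ) - 1 = 1 from rfl, pow_one]; exact hθ'1) hE hρ hρ1

end Summit.QuantumFields.BalabanUV.T4Continuum.NE9.TowerCarriersWitness
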